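import Mathlib
import HarnessLib
import Summits.Ventures.LatticeQCDFlow.Exactness.SUNLeapfrogFTHMCErgodic
import Summits.Ventures.LatticeQCDFlow.Exactness.SUNMultiStepLeapfrogHMCEngine
import Summits.Ventures.LatticeQCDFlow.Exactness.SU2MultiStepLeapfrogHMC

/-!
# Field-transformed MULTI-STEP leapfrog HMC on `SU(N)` lattice gauge fields: exact at every `nstep`, uniformly ergodic for short trajectories — any coordinates, and `SU(2)` in Pauli coordinates; trajectory-length form

HONEST FRAMING: exact (Metropolis-corrected) sampling algorithms for lattice gauge theory;
figures of merit are autocorrelation/cost numbers at stated couplings and volumes; no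
continuum-physics claim.

Venture `LatticeQCDFlow` (cell pub-lqcd), topic `Exactness`; FANOUT row 14 (`eng-flowhmc`, engine
`latflow.fthmc`, family B: HMC in the trivialized variables `V = F⁻¹(U)` for the pulled-back action
`S∘F − log J` with `nstep ≥ 1` leapfrog steps, reported through the member `F`; on the `SU(2)` rung
the kernel of record at `nstep = n` is row 9's `su2LeapfrogHMCN`).  NEW WORK of the cell over the tree
(row 9's `SUNMultiStepLeapfrogHMC(Ergodic|Engine).lean`: the `n`-step kernel `sunLeapfrogHMCN`, exact at
every `nstep`, a Doeblin power under the short-trajectory hypothesis; `SUNLeapfrogFTHMCErgodic.lean`: the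
`nstep = 1` field-transformed twin, `abs_modifiedAction_le`, `measurable_modifiedAction`;
`SU2MultiStepLeapfrogHMC.lean`: the Pauli-coordinate `SU(2)` kernel `su2LeapfrogHMCN`;
`TransformedKernel(Convergence).lean`: `conjKernel`, `conjKernel_nHit`, `conjKernel_minorised`,
`thmc_config_exact`; `MetropolisSweepConvergence.uniformlyErgodic_of_nHit_minorised`,
`DoeblinUniqueness`); nothing here is cited as a fact; no number.  Printed counterparts, NAMED ONLY:
Lüscher 2010 (trivializing maps / field-transformed HMC); Duane–Kennedy–Pendleton–Roweth 1987.
The `SU(N)` twin of row 9's `U1MultiStepFTHMCErgodic.lean`; every `SU(N)` / `SU(2)` field-transformed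
file of the tree listed `nstep ≥ 2` as NOT CLAIMED.

THE POINT.  The Doeblin POWER of the `n`-step `V`-chain (`sunLeapfrogHMCN_nHit_minorised`, for the
modified action `S∘F − log J`, which is bounded and measurable as soon as `S` is and `J` is pinched)
passes through the measurable re-labelling `F` (`conjKernel_nHit` + `conjKernel_minorised`), and
`thmc_config_exact` with the `n`-step Liouville / time-reversal facts says the reported kernel's
invariant law is `e^{−S}·Haar^{⊗links}`.

* §1 (any linear coordinates `ι` of `𝔰𝔲(N)`, any additive Haar measure, any kinetic term bounded on
  boxes with `Z_T < ∞`) `sunLeapfrogFTHMCN_invariant` (+ `_gibbs`) — EXACT AT EVERY `nstep`;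
  **`sunLeapfrogFTHMCN_nHit_minorised`**, **`sunLeapfrogFTHMCN_uniformlyErgodic`**,
  **`sunLeapfrogFTHMCN_invariant_unique`** — for `ε > 0`, `n ≥ 1`, a measurable increment (used in
  the trivialized variables) bounded by `b ≥ 0` per link and `K_g`-Lipschitz in the matrix sup norm, a
  measurable action `|S| ≤ s`, a measurable equivalence `F` with `HasJacobian Haar^⊗ F J`,
  `0 < j₁ ≤ J ≤ j₂` measurable, and `nε, (2n+1)b, K_g εn² ≤ sunShortTrajThreshold ι _`:
  `|μ₀K̃ₙᵗ(A) − π_S(A)| ≤ (1 − δ)^{⌊t/(k+1)⌋}` for EVERY initial law; `π_S` the unique invariant law.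
* §2 `SU(2)` in Pauli coordinates (row 9's `su2LeapfrogHMCN ε κ`): `su2LeapfrogFTHMCN_invariant`,
  **`su2LeapfrogFTHMCN_uniformlyErgodic`** / **`_invariant_unique`**, and the TRAJECTORY-LENGTH FORM
  **`su2LeapfrogFTHMCN_uniformlyErgodic_of_trajLength`**: for a measurable force field `Φ` on the
  trivialized variables bounded by `Φ_max` per link and `K_Φ`-Lipschitz there is `τ₀ > 0` such that
  EVERY `n ≥ 1`, `ε > 0` with `nε ≤ τ₀` give a convergent reported chain with the half kick `−(ε/2)·Φ`
  (the engine's `SU(N)` coordinates: the sequel `SUNMultiStepLeapfrogFTHMCEngine`).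

NOT CLAIMED: anything beyond the short-trajectory threshold (long fixed-length trajectories can be
non-ergodic, Mackenzie 1989); any usable value of the threshold, of `k` or of `δ` (inverse function
theorem and compactness); which members `F` are certified and which force fields are bounded and
Lipschitz (the cell's member files; the exact force through the `SU(2)` LO member is the subject of
the sequel); OMF words / `tau_jitter`; floating point; any number.
-/

noncomputable section

namespace Summit.Ventures.LatticeQCDFlow.Exactness

open MeasureTheory ProbabilityTheory ProbabilityTheory.Kernel Set Metric Function NormedSpace
open Literature.MathematicalPhysics.QuantumFieldTheory (haarProbability)
open scoped ENNReal Matrix Matrix.Norms.Operator NNReal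

set_option backward.isDefEq.respectTransparency false

/-! ## §1 Any coordinates: exactness at every `nstep`, a Doeblin power, uniform ergodicity, uniqueness -/

section FTHMCN

variable {n : Type*} [Fintype n] [DecidableEq n]
variable {E : Type*} [NormedAddCommGroup E] [NormedSpace ℝ E] [MeasurableSpace E] [BorelSpace E]
  [FiniteDimensional ℝ E]
variable (ι : E →ₗ[ℝ] Matrix n n ℂ) (hι : ∀ a, (ι a)ᴴ = -ι a ∧ (ι a).trace = 0)
variable {L : Type*} [Fintype L] (μ : Measure E) [μ.IsAddHaarMeasure]
variable {T : (L → E) → ℝ} {τ : ℝ → ℝ} {ε : ℝ} {N : ℕ} {g : (L → Matrix.specialUnitaryGroup n ℂ) → L → E}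
  {S : (L → Matrix.specialUnitaryGroup n ℂ) → ℝ} {s b Kg : ℝ}
  {F : (L → Matrix.specialUnitaryGroup n ℂ) ≃ᵐ (L → Matrix.specialUnitaryGroup n ℂ)}
  {J : (L → Matrix.specialUnitaryGroup n ℂ) → ℝ} {j₁ j₂ : ℝ}

/-- **The reported `n`-step FT-HMC kernel is exact**: `n`-step leapfrog HMC for the modified action
`S∘F − log J` on the trivialized variables, reported through `F`, leaves `e^{−S}·Haar^{⊗links}`
invariant at EVERY `nstep` (`thmc_config_exact` with the `n`-step Liouville / time-reversal facts). -/
theorem sunLeapfrogFTHMCN_invariant (hg : Measurable g) (hT : Measurable T)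
    (hZ : sunMomentumWeight (L := L) μ T univ ≠ ⊤) (hJ : ∀ v, 0 < J v) (hJm : Measurable J)
    (hF : HasJacobian (Measure.pi fun _ : L => haarProbability (Matrix.specialUnitaryGroup n ℂ)) F
      fun v => ENNReal.ofReal (J v))
    (hS : Measurable S) (N : ℕ) :
    Invariant (conjKernel (sunLeapfrogHMCN ι hι ε μ T hg (fun v => S (F v) - Real.log (J v)) N) F)
      ((Measure.pi fun _ : L => haarProbability (Matrix.specialUnitaryGroup n ℂ)).withDensity
        fun u => ENNReal.ofReal (Real.exp (-S u))) :=
  thmc_config_exact (vol := Measure.pi fun _ : L => haarProbability (Matrix.specialUnitaryGroup n ℂ))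
    (volP := Measure.pi fun _ : L => μ) (hΦ := measurable_sunLeapfrogProposalN ι hι ε N hg) hJ hJm hF hS hT
    (involutive_sunLeapfrogProposalN ι hι ε g N) (measurePreserving_sunLeapfrogProposalN ι hι ε N μ hg)
    (sunMomentumWeight_univ_ne_zero μ T hT) hZ

/-- … and the normalised Gibbs law is invariant, at every `nstep`. -/
theorem sunLeapfrogFTHMCN_invariant_gibbs (hg : Measurable g) (hT : Measurable T)
    (hZ : sunMomentumWeight (L := L) μ T univ ≠ ⊤) (hJ : ∀ v, 0 < J v) (hJm : Measurable J)
    (hF : HasJacobian (Measure.pi fun _ : L => haarProbability (Matrix.specialUnitaryGroup n ℂ)) F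
      fun v => ENNReal.ofReal (J v))
    (hS : Measurable S) (N : ℕ) :
    Invariant (conjKernel (sunLeapfrogHMCN ι hι ε μ T hg (fun v => S (F v) - Real.log (J v)) N) F)
      (gibbsProbability (Measure.pi fun _ : L => haarProbability (Matrix.specialUnitaryGroup n ℂ))
        fun u => Real.exp (-S u)) :=
  invariant_gibbsProbability (sunLeapfrogFTHMCN_invariant ι hι μ hg hT hZ hJ hJm hF hS N)

variable [Nonempty n] (hinj : Injective ι)

/-- **A POWER OF THE REPORTED `n`-STEP KERNEL IS DOEBLIN** for short trajectories:
`K̃ₙ^{k+1}(x, ·) ≥ δ · F_* Haar^{⊗links}` from every `x` (the trivialized chain's Doeblin power,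
`sunLeapfrogHMCN_nHit_minorised` for the bounded measurable modified action, passes through `F`). -/
theorem sunLeapfrogFTHMCN_nHit_minorised
    (hsurj : ∀ X : Matrix n n ℂ, Xᴴ = -X → X.trace = 0 → X ∈ LinearMap.range ι)
    (hε : 0 < ε) (hN : 1 ≤ N) (hT : Measurable T) (hT0 : ∀ p, 0 ≤ T p)
    (hTle : ∀ (R : ℝ) (p : L → E), (∀ l, ‖p l‖ ≤ R) → T p ≤ τ R) (hZ : sunMomentumWeight (L := L) μ T univ ≠ ⊤)
    (hg : Measurable g) (hb0 : 0 ≤ b) (hb : ∀ u l, ‖g u l‖ ≤ b) (hK0 : 0 ≤ Kg)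
    (hK : ∀ U U', ‖g U - g U'‖ ≤ Kg * ‖coeConfig U - coeConfig U'‖)
    (hS : Measurable S) (hs : ∀ u, |S u| ≤ s)
    (hj₁ : 0 < j₁) (hJ₁ : ∀ v, j₁ ≤ J v) (hJ₂ : ∀ v, J v ≤ j₂) (hJm : Measurable J)
    (h1 : N * ε ≤ sunShortTrajThreshold ι hinj) (h2 : (2 * N + 1) * b ≤ sunShortTrajThreshold ι hinj)
    (h3 : Kg * ε * (N : ℝ) ^ 2 ≤ sunShortTrajThreshold ι hinj) :
    ∃ k : ℕ, ∃ δ : ℝ≥0∞, 0 < δ ∧ ∀ x,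
      δ • (Measure.pi fun _ : L => haarProbability (Matrix.specialUnitaryGroup n ℂ)).map F ≤
        nHit (conjKernel (sunLeapfrogHMCN ι hι ε μ T hg (fun v => S (F v) - Real.log (J v)) N) F) (k + 1) x := by
  obtain ⟨k, δ, hδ, hmin⟩ := sunLeapfrogHMCN_nHit_minorised ι hι hinj μ (τ := τ) hsurj hε hN hT hT0 hTle hZ hg hb0 hb
    hK0 hK (measurable_modifiedAction hS hJm) (abs_modifiedAction_le (F := F) hs hj₁ hJ₁ hJ₂) h1 h2 h3
  refine ⟨k, δ, hδ, fun x => ?_⟩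
  rw [← conjKernel_nHit]
  exact conjKernel_minorised hmin F x

/-- **FIELD-TRANSFORMED `n`-STEP LEAPFROG HMC ON `SU(N)^links` IS UNIFORMLY ERGODIC FOR SHORT
TRAJECTORIES**: with the hypotheses of `sunLeapfrogFTHMCN_nHit_minorised` and `HasJacobian Haar^⊗ F J`,
there are `k` and `δ ∈ (0, 1]` with `|μ₀K̃ₙᵗ(A) − π_S(A)| ≤ (1 − δ)^{⌊t/(k+1)⌋}` for EVERY initial law
`μ₀`, every `t`, every `A` (`π_S = gibbsProbability Haar^⊗ e^{−S}`, `K̃ₙ` the reported kernel). -/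
theorem sunLeapfrogFTHMCN_uniformlyErgodic
    (hsurj : ∀ X : Matrix n n ℂ, Xᴴ = -X → X.trace = 0 → X ∈ LinearMap.range ι)
    (hε : 0 < ε) (hN : 1 ≤ N) (hT : Measurable T) (hT0 : ∀ p, 0 ≤ T p)
    (hTle : ∀ (R : ℝ) (p : L → E), (∀ l, ‖p l‖ ≤ R) → T p ≤ τ R) (hZ : sunMomentumWeight (L := L) μ T univ ≠ ⊤)
    (hg : Measurable g) (hb0 : 0 ≤ b) (hb : ∀ u l, ‖g u l‖ ≤ b) (hK0 : 0 ≤ Kg)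
    (hK : ∀ U U', ‖g U - g U'‖ ≤ Kg * ‖coeConfig U - coeConfig U'‖)
    (hS : Measurable S) (hs : ∀ u, |S u| ≤ s)
    (hj₁ : 0 < j₁) (hJ₁ : ∀ v, j₁ ≤ J v) (hJ₂ : ∀ v, J v ≤ j₂) (hJm : Measurable J)
    (hF : HasJacobian (Measure.pi fun _ : L => haarProbability (Matrix.specialUnitaryGroup n ℂ)) F
      fun v => ENNReal.ofReal (J v))
    (h1 : N * ε ≤ sunShortTrajThreshold ι hinj) (h2 : (2 * N + 1) * b ≤ sunShortTrajThreshold ι hinj)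
    (h3 : Kg * ε * (N : ℝ) ^ 2 ≤ sunShortTrajThreshold ι hinj) :
    ∃ k : ℕ, ∃ δ : ℝ, 0 < δ ∧ δ ≤ 1 ∧ ∀ (μ₀ : Measure (L → Matrix.specialUnitaryGroup n ℂ))
      [IsProbabilityMeasure μ₀] (t : ℕ) (A : Set (L → Matrix.specialUnitaryGroup n ℂ)),
      |((fun m : Measure (L → Matrix.specialUnitaryGroup n ℂ) =>
            m.bind (conjKernel (sunLeapfrogHMCN ι hι ε μ T hg (fun v => S (F v) - Real.log (J v)) N) F))^[t] μ₀).real A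
          - (gibbsProbability (Measure.pi fun _ : L => haarProbability (Matrix.specialUnitaryGroup n ℂ))
              (fun u => Real.exp (-S u))).real A| ≤ (1 - δ) ^ (t / (k + 1)) := by
  obtain ⟨hlo, hhi⟩ := gibbsWeight_pinched (L := L) (n := n) hs
  haveI := isProbabilityMeasure_gibbsProbability
    (μ := Measure.pi fun _ : L => haarProbability (Matrix.specialUnitaryGroup n ℂ)) (Real.exp_pos (-s)) hlo hhi
  haveI := isProbabilityMeasure_sunMomentumLaw (L := L) μ T hT hZ
  have hJ : ∀ v, 0 < J v := fun v => hj₁.trans_le (hJ₁ v)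
  have hSt := measurable_modifiedAction (F := F) hS hJm
  have hH : Measurable fun z : (L → Matrix.specialUnitaryGroup n ℂ) × (L → E) =>
      (S (F z.1) - Real.log (J z.1)) + T z.2 := (hSt.comp measurable_fst).add (hT.comp measurable_snd)
  haveI : Fact (Measurable fun z : (L → Matrix.specialUnitaryGroup n ℂ) × (L → E) =>
      (S (F z.1) - Real.log (J z.1)) + T z.2) := ⟨hH⟩
  haveI : IsMarkovKernel (sunLeapfrogHMCN ι hι ε μ T hg (fun v => S (F v) - Real.log (J v)) N) := by
    unfold sunLeapfrogHMCN; infer_instance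
  haveI : IsProbabilityMeasure ((Measure.pi fun _ : L =>
      haarProbability (Matrix.specialUnitaryGroup n ℂ)).map F) :=
    Measure.isProbabilityMeasure_map F.measurable.aemeasurable
  obtain ⟨k, δ, hδ0, hmin⟩ := sunLeapfrogFTHMCN_nHit_minorised ι hι μ hinj (τ := τ) hsurj hε hN hT hT0 hTle hZ hg hb0 hb
    hK0 hK hS hs hj₁ hJ₁ hJ₂ hJm (F := F) h1 h2 h3
  haveI : IsMarkovKernel (nHit (conjKernel (sunLeapfrogHMCN ι hι ε μ T hg (fun v => S (F v) - Real.log (J v)) N) F) (k + 1)) :=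
    isMarkovKernel_nHit _ _
  have hδ1 : δ ≤ 1 := by
    have h := Measure.le_iff'.1 (hmin (F fun _ => 1)) univ
    rwa [Measure.smul_apply, smul_eq_mul, measure_univ, measure_univ, mul_one] at h
  have hδtop : δ ≠ ⊤ := ne_top_of_le_ne_top ENNReal.one_ne_top hδ1
  refine ⟨k, δ.toReal, ENNReal.toReal_pos hδ0.ne' hδtop,
    ENNReal.toReal_le_of_le_ofReal zero_le_one (by rwa [ENNReal.ofReal_one]), fun μ₀ _ t A => ?_⟩
  exact uniformlyErgodic_of_nHit_minorised hmin (sunLeapfrogFTHMCN_invariant_gibbs ι hι μ hg hT hZ hJ hJm hF hS N) μ₀ t A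

/-- **The Gibbs law is the unique invariant probability law of the reported `n`-step FT-HMC kernel**
(same hypotheses). -/
theorem sunLeapfrogFTHMCN_invariant_unique
    (hsurj : ∀ X : Matrix n n ℂ, Xᴴ = -X → X.trace = 0 → X ∈ LinearMap.range ι)
    (hε : 0 < ε) (hN : 1 ≤ N) (hT : Measurable T) (hT0 : ∀ p, 0 ≤ T p)
    (hTle : ∀ (R : ℝ) (p : L → E), (∀ l, ‖p l‖ ≤ R) → T p ≤ τ R) (hZ : sunMomentumWeight (L := L) μ T univ ≠ ⊤)
    (hg : Measurable g) (hb0 : 0 ≤ b) (hb : ∀ u l, ‖g u l‖ ≤ b) (hK0 : 0 ≤ Kg)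
    (hK : ∀ U U', ‖g U - g U'‖ ≤ Kg * ‖coeConfig U - coeConfig U'‖)
    (hS : Measurable S) (hs : ∀ u, |S u| ≤ s)
    (hj₁ : 0 < j₁) (hJ₁ : ∀ v, j₁ ≤ J v) (hJ₂ : ∀ v, J v ≤ j₂) (hJm : Measurable J)
    (hF : HasJacobian (Measure.pi fun _ : L => haarProbability (Matrix.specialUnitaryGroup n ℂ)) F
      fun v => ENNReal.ofReal (J v))
    (h1 : N * ε ≤ sunShortTrajThreshold ι hinj) (h2 : (2 * N + 1) * b ≤ sunShortTrajThreshold ι hinj)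
    (h3 : Kg * ε * (N : ℝ) ^ 2 ≤ sunShortTrajThreshold ι hinj)
    {π' : Measure (L → Matrix.specialUnitaryGroup n ℂ)} [IsProbabilityMeasure π']
    (hπ' : Invariant (conjKernel (sunLeapfrogHMCN ι hι ε μ T hg (fun v => S (F v) - Real.log (J v)) N) F) π') :
    π' = gibbsProbability (Measure.pi fun _ : L => haarProbability (Matrix.specialUnitaryGroup n ℂ))
      (fun u => Real.exp (-S u)) := by
  obtain ⟨hlo, hhi⟩ := gibbsWeight_pinched (L := L) (n := n) hs
  haveI := isProbabilityMeasure_gibbsProbability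
    (μ := Measure.pi fun _ : L => haarProbability (Matrix.specialUnitaryGroup n ℂ)) (Real.exp_pos (-s)) hlo hhi
  haveI := isProbabilityMeasure_sunMomentumLaw (L := L) μ T hT hZ
  have hJ : ∀ v, 0 < J v := fun v => hj₁.trans_le (hJ₁ v)
  have hSt := measurable_modifiedAction (F := F) hS hJm
  haveI : Fact (Measurable fun z : (L → Matrix.specialUnitaryGroup n ℂ) × (L → E) =>
      (S (F z.1) - Real.log (J z.1)) + T z.2) := ⟨(hSt.comp measurable_fst).add (hT.comp measurable_snd)⟩
  haveI : IsMarkovKernel (sunLeapfrogHMCN ι hι ε μ T hg (fun v => S (F v) - Real.log (J v)) N) := by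
    unfold sunLeapfrogHMCN; infer_instance
  haveI : IsProbabilityMeasure ((Measure.pi fun _ : L =>
      haarProbability (Matrix.specialUnitaryGroup n ℂ)).map F) :=
    Measure.isProbabilityMeasure_map F.measurable.aemeasurable
  obtain ⟨k, δ, hδ0, hmin⟩ := sunLeapfrogFTHMCN_nHit_minorised ι hι μ hinj (τ := τ) hsurj hε hN hT hT0 hTle hZ hg hb0 hb
    hK0 hK hS hs hj₁ hJ₁ hJ₂ hJm (F := F) h1 h2 h3
  haveI : IsMarkovKernel (nHit (conjKernel (sunLeapfrogHMCN ι hι ε μ T hg (fun v => S (F v) - Real.log (J v)) N) F) (k + 1)) :=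
    isMarkovKernel_nHit _ _
  exact invariant_unique_of_minorised hmin hδ0
    (invariant_nHit (sunLeapfrogFTHMCN_invariant_gibbs ι hι μ hg hT hZ hJ hJm hF hS N) (k + 1)) (invariant_nHit hπ' (k + 1))

end FTHMCN

/-! ## §2 `SU(2)` in Pauli coordinates (row 9's `su2LeapfrogHMCN`); trajectory-length form -/

section Pauli

variable {ι : Type*} [Fintype ι] {ε κ : ℝ} {n : ℕ}
  {g : (ι → Matrix.specialUnitaryGroup (Fin 2) ℂ) → ι → EuclideanSpace ℝ (Fin 3)}
  {S : (ι → Matrix.specialUnitaryGroup (Fin 2) ℂ) → ℝ} {b Kg s : ℝ}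
  {F : (ι → Matrix.specialUnitaryGroup (Fin 2) ℂ) ≃ᵐ (ι → Matrix.specialUnitaryGroup (Fin 2) ℂ)}
  {J : (ι → Matrix.specialUnitaryGroup (Fin 2) ℂ) → ℝ} {j₁ j₂ : ℝ}

/-- **The reported `n`-step `SU(2)` FT-HMC kernel (Pauli coordinates) is exact at every `nstep`**
(`κ > 0`, any `ε`, measurable `g`, `S`, member `F` with positive measurable Jacobian `J`). -/
theorem su2LeapfrogFTHMCN_invariant (hκ : 0 < κ) (hg : Measurable g) (hJ : ∀ v, 0 < J v) (hJm : Measurable J)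
    (hF : HasJacobian (Measure.pi fun _ : ι => haarProbability (Matrix.specialUnitaryGroup (Fin 2) ℂ)) F
      fun v => ENNReal.ofReal (J v))
    (hS : Measurable S) (n : ℕ) :
    Invariant (conjKernel (su2LeapfrogHMCN ε κ hg (fun v => S (F v) - Real.log (J v)) n) F)
      ((Measure.pi fun _ : ι => haarProbability (Matrix.specialUnitaryGroup (Fin 2) ℂ)).withDensity
        fun u => ENNReal.ofReal (Real.exp (-S u))) :=
  sunLeapfrogFTHMCN_invariant pauliCoordι pauliCoordι_skew volume hg (measurable_su2Kinetic κ)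
    (by rw [sunMomentumWeight_pauli]; exact su2MomentumWeight_univ_ne_top hκ) hJ hJm hF hS n

/-- **FIELD-TRANSFORMED `n`-STEP LEAPFROG HMC ON `SU(2)^ι` (PAULI COORDINATES) IS UNIFORMLY ERGODIC FOR
SHORT TRAJECTORIES**: `ε, κ > 0`, `n ≥ 1`, a measurable increment `|g| ≤ b` (`b ≥ 0`) that is
`K_g`-Lipschitz (`K_g ≥ 0`) in the matrix sup norm, a measurable `|S| ≤ s`, a member `F` with
`HasJacobian Haar^⊗ F J`, `0 < j₁ ≤ J ≤ j₂` measurable, and `nε, (2n+1)b, K_g εn² ≤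
sunShortTrajThreshold pauliCoordι _`: `|μ₀K̃ₙᵗ(A) − su2GibbsLaw S (A)| ≤ (1 − δ)^{⌊t/(k+1)⌋}` for EVERY
initial law `μ₀`, every `t`, every `A`. -/
theorem su2LeapfrogFTHMCN_uniformlyErgodic (hε : 0 < ε) (hκ : 0 < κ) (hn : 1 ≤ n) (hg : Measurable g)
    (hb0 : 0 ≤ b) (hb : ∀ u l, ‖g u l‖ ≤ b) (hK0 : 0 ≤ Kg)
    (hK : ∀ U U', ‖g U - g U'‖ ≤ Kg * ‖coeConfig U - coeConfig U'‖) (hS : Measurable S) (hs : ∀ u, |S u| ≤ s)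
    (hj₁ : 0 < j₁) (hJ₁ : ∀ v, j₁ ≤ J v) (hJ₂ : ∀ v, J v ≤ j₂) (hJm : Measurable J)
    (hF : HasJacobian (Measure.pi fun _ : ι => haarProbability (Matrix.specialUnitaryGroup (Fin 2) ℂ)) F
      fun v => ENNReal.ofReal (J v))
    (h1 : n * ε ≤ sunShortTrajThreshold pauliCoordι pauliCoordι_injective)
    (h2 : (2 * n + 1) * b ≤ sunShortTrajThreshold pauliCoordι pauliCoordι_injective)
    (h3 : Kg * ε * (n : ℝ) ^ 2 ≤ sunShortTrajThreshold pauliCoordι pauliCoordι_injective) :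
    ∃ k : ℕ, ∃ δ : ℝ, 0 < δ ∧ δ ≤ 1 ∧ ∀ (μ₀ : Measure (ι → Matrix.specialUnitaryGroup (Fin 2) ℂ))
      [IsProbabilityMeasure μ₀] (t : ℕ) (A : Set (ι → Matrix.specialUnitaryGroup (Fin 2) ℂ)),
      |((fun m : Measure (ι → Matrix.specialUnitaryGroup (Fin 2) ℂ) =>
            m.bind (conjKernel (su2LeapfrogHMCN ε κ hg (fun v => S (F v) - Real.log (J v)) n) F))^[t] μ₀).real A
          - (su2GibbsLaw S).real A| ≤ (1 - δ) ^ (t / (k + 1)) := by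
  rw [← gibbsProbability_eq_su2GibbsLaw]
  exact sunLeapfrogFTHMCN_uniformlyErgodic pauliCoordι pauliCoordι_skew volume pauliCoordι_injective
    (τ := fun R => κ * (Fintype.card ι * R ^ 2)) pauliCoordι_range hε hn (measurable_su2Kinetic κ)
    (su2Kinetic_nonneg hκ.le) (fun R p hp => su2Kinetic_le_of_norm_le hκ.le hp)
    (by rw [sunMomentumWeight_pauli]; exact su2MomentumWeight_univ_ne_top hκ) hg hb0 hb hK0 hK hS hs
    hj₁ hJ₁ hJ₂ hJm hF h1 h2 h3

/-- **`su2GibbsLaw S` is the unique invariant probability law of the reported `n`-step `SU(2)` FT-HMC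
kernel**, for short trajectories (same hypotheses). -/
theorem su2LeapfrogFTHMCN_invariant_unique (hε : 0 < ε) (hκ : 0 < κ) (hn : 1 ≤ n) (hg : Measurable g)
    (hb0 : 0 ≤ b) (hb : ∀ u l, ‖g u l‖ ≤ b) (hK0 : 0 ≤ Kg)
    (hK : ∀ U U', ‖g U - g U'‖ ≤ Kg * ‖coeConfig U - coeConfig U'‖) (hS : Measurable S) (hs : ∀ u, |S u| ≤ s)
    (hj₁ : 0 < j₁) (hJ₁ : ∀ v, j₁ ≤ J v) (hJ₂ : ∀ v, J v ≤ j₂) (hJm : Measurable J)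
    (hF : HasJacobian (Measure.pi fun _ : ι => haarProbability (Matrix.specialUnitaryGroup (Fin 2) ℂ)) F
      fun v => ENNReal.ofReal (J v))
    (h1 : n * ε ≤ sunShortTrajThreshold pauliCoordι pauliCoordι_injective)
    (h2 : (2 * n + 1) * b ≤ sunShortTrajThreshold pauliCoordι pauliCoordι_injective)
    (h3 : Kg * ε * (n : ℝ) ^ 2 ≤ sunShortTrajThreshold pauliCoordι pauliCoordι_injective)
    {π' : Measure (ι → Matrix.specialUnitaryGroup (Fin 2) ℂ)} [IsProbabilityMeasure π']
    (hπ' : Invariant (conjKernel (su2LeapfrogHMCN ε κ hg (fun v => S (F v) - Real.log (J v)) n) F) π') :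
    π' = su2GibbsLaw S := by
  rw [← gibbsProbability_eq_su2GibbsLaw]
  exact sunLeapfrogFTHMCN_invariant_unique pauliCoordι pauliCoordι_skew volume pauliCoordι_injective
    (τ := fun R => κ * (Fintype.card ι * R ^ 2)) pauliCoordι_range hε hn (measurable_su2Kinetic κ)
    (su2Kinetic_nonneg hκ.le) (fun R p hp => su2Kinetic_le_of_norm_le hκ.le hp)
    (by rw [sunMomentumWeight_pauli]; exact su2MomentumWeight_univ_ne_top hκ) hg hb0 hb hK0 hK hS hs
    hj₁ hJ₁ hJ₂ hJm hF h1 h2 h3 hπ'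

variable {Φ : (ι → Matrix.specialUnitaryGroup (Fin 2) ℂ) → ι → EuclideanSpace ℝ (Fin 3)} {Φmax KΦ : ℝ}

omit [Fintype ι] in
/-- The half kick `−(ε/2)·Φ` of an `ℝ³`-valued field is measurable. -/
theorem measurable_halfKick_su2 (hΦ : Measurable Φ) (ε : ℝ) :
    Measurable fun U : ι → Matrix.specialUnitaryGroup (Fin 2) ℂ => (-(ε / 2)) • Φ U :=
  measurable_pi_lambda _ fun l =>
    (continuous_const_smul (-(ε / 2))).measurable.comp ((measurable_pi_apply l).comp hΦ)

/-- **`SU(2)` FIELD-TRANSFORMED HMC IN TRAJECTORY-LENGTH FORM (Pauli coordinates).**  For a measurable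
force field `Φ` on the trivialized variables bounded by `Φ_max` per link and `K_Φ`-Lipschitz in the
matrix sup norm, `κ > 0`, a measurable action `|S| ≤ s` and a member `F` with pinched measurable
Jacobian: there is `τ₀ > 0` (`Φ_max`, `K_Φ` only) such that for EVERY `n ≥ 1`, `ε > 0` with `nε ≤ τ₀`
the reported `n`-step chain `conjKernel (su2LeapfrogHMCN ε κ (−(ε/2)·Φ) (S∘F − log J) n) F` converges
to `su2GibbsLaw S` from every initial law geometrically in total variation. -/
theorem su2LeapfrogFTHMCN_uniformlyErgodic_of_trajLength (hκ : 0 < κ) (hΦ : Measurable Φ) (hΦ0 : 0 ≤ Φmax)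
    (hΦb : ∀ U l, ‖Φ U l‖ ≤ Φmax) (hKΦ0 : 0 ≤ KΦ) (hΦK : ∀ U U', ‖Φ U - Φ U'‖ ≤ KΦ * ‖coeConfig U - coeConfig U'‖)
    (hS : Measurable S) (hs : ∀ u, |S u| ≤ s)
    (hj₁ : 0 < j₁) (hJ₁ : ∀ v, j₁ ≤ J v) (hJ₂ : ∀ v, J v ≤ j₂) (hJm : Measurable J)
    (hF : HasJacobian (Measure.pi fun _ : ι => haarProbability (Matrix.specialUnitaryGroup (Fin 2) ℂ)) F
      fun v => ENNReal.ofReal (J v)) :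
    ∃ τ₀ : ℝ, 0 < τ₀ ∧ ∀ (n : ℕ) (ε : ℝ) (hn : 1 ≤ n) (hε : 0 < ε), n * ε ≤ τ₀ →
      ∃ k : ℕ, ∃ δ : ℝ, 0 < δ ∧ δ ≤ 1 ∧ ∀ (μ₀ : Measure (ι → Matrix.specialUnitaryGroup (Fin 2) ℂ))
        [IsProbabilityMeasure μ₀] (t : ℕ) (A : Set (ι → Matrix.specialUnitaryGroup (Fin 2) ℂ)),
        |((fun m : Measure (ι → Matrix.specialUnitaryGroup (Fin 2) ℂ) =>
              m.bind (conjKernel (su2LeapfrogHMCN ε κ (measurable_halfKick_su2 hΦ ε)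
                (fun v => S (F v) - Real.log (J v)) n) F))^[t] μ₀).real A
            - (su2GibbsLaw S).real A| ≤ (1 - δ) ^ (t / (k + 1)) := by
  set s₀ := sunShortTrajThreshold pauliCoordι pauliCoordι_injective with hs₀
  have hs₀0 : 0 < s₀ := sunShortTrajThreshold_pos _ _
  refine ⟨min s₀ (min (s₀ / (3 * Φmax + 1)) (Real.sqrt (s₀ / (KΦ + 1)))),
    lt_min hs₀0 (lt_min (by positivity) (Real.sqrt_pos.2 (by positivity))), fun n ε hn hε hτ => ?_⟩
  obtain ⟨h1, h2, h3⟩ := trajLength_threshold_arith hs₀0 hΦ0 hKΦ0 hn hε rfl hτ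
  refine su2LeapfrogFTHMCN_uniformlyErgodic hε hκ hn (measurable_halfKick_su2 hΦ ε) (b := ε / 2 * Φmax)
    (Kg := ε / 2 * KΦ) (by positivity) (fun U l => ?_) (by positivity) (fun U U' => ?_) hS hs hj₁ hJ₁ hJ₂ hJm hF h1 h2 h3
  · rw [Pi.smul_apply, norm_smul, Real.norm_eq_abs, abs_neg, abs_of_pos (by positivity)]
    exact mul_le_mul_of_nonneg_left (hΦb U l) (by positivity)
  · have hsub : (-(ε / 2)) • Φ U - (-(ε / 2)) • Φ U' = (-(ε / 2)) • (Φ U - Φ U') := by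
      funext l; simp only [Pi.sub_apply, Pi.smul_apply, smul_sub]
    rw [hsub, norm_smul, Real.norm_eq_abs, abs_neg, abs_of_pos (by positivity), mul_assoc]
    exact mul_le_mul_of_nonneg_left (hΦK U U') (by positivity)

end Pauli

/-! ## §3 The trajectory-length threshold chosen BEFORE the link set (appended, GEN-15)

The threshold `sunShortTrajThreshold pauliCoordι` of §2 involves the coordinates only, so the `τ₀` of
`su2LeapfrogFTHMCN_uniformlyErgodic_of_trajLength` can be chosen from `Φ_max, K_Φ` before the link set
is named: ONE `τ₀` serves every finite volume (used by `SU2ExactForceVolumeUniform`). -/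

section Threshold

/-- **MULTI-STEP `SU(2)` FT-HMC IN TRAJECTORY-LENGTH FORM, THRESHOLD FIRST.**  For `κ > 0` and constants
`Φ_max, K_Φ ≥ 0` there is `τ₀ > 0` such that for EVERY finite link set `ι`, every measurable force field
`Φ` on `SU(2)^ι` bounded by `Φ_max` per link and `K_Φ`-Lipschitz in the matrix sup norm, every measurable
action `|S| ≤ s`, every member `F` with pinched measurable Jacobian, and every `n ≥ 1`, `ε > 0` with
`nε ≤ τ₀`, the reported `n`-step chain converges to `su2GibbsLaw S` from every initial law, geometrically
in total variation (the twin of `su2LeapfrogFTHMCN_uniformlyErgodic_of_trajLength` with the quantifiers in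
the order that makes `τ₀` volume-free). -/
theorem su2LeapfrogFTHMCN_uniformlyErgodic_of_trajLength_uniform {κ Φmax KΦ : ℝ} (hκ : 0 < κ)
    (hΦ0 : 0 ≤ Φmax) (hKΦ0 : 0 ≤ KΦ) :
    ∃ τ₀ : ℝ, 0 < τ₀ ∧ ∀ (ι : Type) [Fintype ι]
      {Φ : (ι → Matrix.specialUnitaryGroup (Fin 2) ℂ) → ι → EuclideanSpace ℝ (Fin 3)} (hΦ : Measurable Φ)
      (_hΦb : ∀ U l, ‖Φ U l‖ ≤ Φmax) (_hΦK : ∀ U U', ‖Φ U - Φ U'‖ ≤ KΦ * ‖coeConfig U - coeConfig U'‖)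
      {S : (ι → Matrix.specialUnitaryGroup (Fin 2) ℂ) → ℝ} (_hS : Measurable S) {s : ℝ} (_hs : ∀ u, |S u| ≤ s)
      {J : (ι → Matrix.specialUnitaryGroup (Fin 2) ℂ) → ℝ} {j₁ j₂ : ℝ} (_hj₁ : 0 < j₁) (_hJ₁ : ∀ v, j₁ ≤ J v)
      (_hJ₂ : ∀ v, J v ≤ j₂) (_hJm : Measurable J)
      {F : (ι → Matrix.specialUnitaryGroup (Fin 2) ℂ) ≃ᵐ (ι → Matrix.specialUnitaryGroup (Fin 2) ℂ)}
      (_hF : HasJacobian (Measure.pi fun _ : ι => haarProbability (Matrix.specialUnitaryGroup (Fin 2) ℂ)) F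
        fun v => ENNReal.ofReal (J v))
      (n : ℕ) (ε : ℝ) (_hn : 1 ≤ n) (_hε : 0 < ε), n * ε ≤ τ₀ →
      ∃ k : ℕ, ∃ δ : ℝ, 0 < δ ∧ δ ≤ 1 ∧ ∀ (μ₀ : Measure (ι → Matrix.specialUnitaryGroup (Fin 2) ℂ))
        [IsProbabilityMeasure μ₀] (t : ℕ) (A : Set (ι → Matrix.specialUnitaryGroup (Fin 2) ℂ)),
        |((fun m : Measure (ι → Matrix.specialUnitaryGroup (Fin 2) ℂ) =>
              m.bind (conjKernel (su2LeapfrogHMCN ε κ (measurable_halfKick_su2 hΦ ε)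
                (fun v => S (F v) - Real.log (J v)) n) F))^[t] μ₀).real A
            - (su2GibbsLaw S).real A| ≤ (1 - δ) ^ (t / (k + 1)) := by
  set s₀ := sunShortTrajThreshold pauliCoordι pauliCoordι_injective with hs₀
  have hs₀0 : 0 < s₀ := sunShortTrajThreshold_pos _ _
  refine ⟨min s₀ (min (s₀ / (3 * Φmax + 1)) (Real.sqrt (s₀ / (KΦ + 1)))),
    lt_min hs₀0 (lt_min (by positivity) (Real.sqrt_pos.2 (by positivity))), ?_⟩
  intro ι _ Φ hΦ hΦb hΦK S hS s hs J j₁ j₂ hj₁ hJ₁ hJ₂ hJm F hF n ε hn hε hτ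
  obtain ⟨h1, h2, h3⟩ := trajLength_threshold_arith hs₀0 hΦ0 hKΦ0 hn hε rfl hτ
  refine su2LeapfrogFTHMCN_uniformlyErgodic hε hκ hn (measurable_halfKick_su2 hΦ ε) (b := ε / 2 * Φmax)
    (Kg := ε / 2 * KΦ) (by positivity) (fun U l => ?_) (by positivity) (fun U U' => ?_) hS hs hj₁ hJ₁ hJ₂ hJm hF h1 h2 h3
  · rw [Pi.smul_apply, norm_smul, Real.norm_eq_abs, abs_neg, abs_of_pos (by positivity)]
    exact mul_le_mul_of_nonneg_left (hΦb U l) (by positivity)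
  · have hsub : (-(ε / 2)) • Φ U - (-(ε / 2)) • Φ U' = (-(ε / 2)) • (Φ U - Φ U') := by
      funext l; simp only [Pi.sub_apply, Pi.smul_apply, smul_sub]
    rw [hsub, norm_smul, Real.norm_eq_abs, abs_neg, abs_of_pos (by positivity), mul_assoc]
    exact mul_le_mul_of_nonneg_left (hΦK U U') (by positivity)

end Threshold

end Summit.Ventures.LatticeQCDFlow.Exactness
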